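import Mathlib.LinearAlgebra.Matrix.PosDef
import Mathlib.LinearAlgebra.Matrix.NonsingularInverse
import HarnessLib

/-!
# PSD witness for a block with a KNOWN kernel basis: delete `k` pivot indices, certify the principal submatrix

The `k`-vector form of the «face block» step of an exact SDP upper-bound certificate (certsdp-primal/1
witness mode «chol-residual-face/1»; the one-vector case `k = 1` is
`Literature.Computation.Certificates.posSemidef_of_mulVec_eq_zero_of_posSemidef_submatrix_erase`, file
`FaceBlockPrincipalSubmatrixWitness.lean`).  A real symmetric block `M = M_k(y*)` comes with `k` exactly
known kernel vectors, the COLUMNS of an `n × k` matrix `U` with `M * U = 0`, and with `k` indices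
`J : k → n` such that the `k × k` block `U_J := U.submatrix J id` (rows `J`, all columns) is invertible,
`det U_J ≠ 0` — a certificate reader checks both hypotheses exactly over `ℚ`.  Then `M` is positive
semidefinite as soon as the principal submatrix of `M` on the COMPLEMENT of the range of `J` is; that
`(n-k) × (n-k)` remainder is what the ordinary Cholesky-residual witness certifies
(`Literature.Analysis.InnerProduct.posSemidef_add_of_residual_le_rowSum`).

The proof is the direct congruence (no induction on `k`): for any `x` put `c := U_J⁻¹ (x ∘ J)` and
`w := x - U c`; then `w` vanishes on the range of `J`, `M w = M x`, and by symmetry `xᵀ M x = wᵀ M w`, which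
is the complement submatrix's quadratic form at the restriction of `w`.  This is the instance
`C := (x ↦ w|_{(range J)ᶜ})` of the congruence observation «`A ⪰ 0 ⇒ C* A C ⪰ 0`» of Horn–Johnson,
Observation 7.1.8, in the coordinate form a certificate reader replays.

Main results:
* `dotProduct_mulVec_eq_submatrix_of_forall_not_apply_eq_zero` — the quadratic form of a vector supported
  on a decidable index set equals the principal submatrix's quadratic form (bookkeeping identity);
* `posSemidef_of_mul_eq_zero_of_posSemidef_submatrix_compl` — the `k`-vector face-block witness.
-/

namespace Literature.Computation.Certificates

open Matrix

variable {n : Type*} [Fintype n] [DecidableEq n]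

omit [DecidableEq n] in
/-- The quadratic form of a real matrix `M` at a vector `w` that VANISHES outside a decidable index set
`p` equals the quadratic form of the principal submatrix of `M` on `{i // p i}` at the restriction of `w`.
[folklore] -/
private theorem dotProduct_mulVec_eq_submatrix_of_forall_not_apply_eq_zero (M : Matrix n n ℝ) {w : n → ℝ}
    (p : n → Prop) [DecidablePred p] (hw : ∀ i, ¬ p i → w i = 0) :
    w ⬝ᵥ (M *ᵥ w) =
      (fun i : {i // p i} => w i) ⬝ᵥ
        ((M.submatrix (Subtype.val : {i // p i} → n) (Subtype.val : {i // p i} → n)) *ᵥ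
          fun i : {i // p i} => w i) := by
  classical
  -- a sum over `n` whose terms vanish outside `p` is the sum over the subtype `{i // p i}`
  have drop : ∀ g : n → ℝ, (∀ i, ¬ p i → g i = 0) → (∑ i, g i) = ∑ i : {i // p i}, g i := by
    intro g hg
    rw [← Finset.sum_filter_of_ne (p := p) (fun i _ hne => by by_contra hpi; exact hne (hg i hpi))]
    exact Finset.sum_subtype (Finset.univ.filter p) (fun i => by simp) g
  simp only [dotProduct, mulVec, submatrix_apply]
  rw [drop (fun i => w i * ∑ l, M i l * w l) (fun i hi => by rw [hw i hi, zero_mul])]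
  refine Finset.sum_congr rfl fun i _ => ?_
  rw [drop (fun l => M (i : n) l * w l) (fun l hl => by rw [hw l hl, mul_zero])]

/-- **Face-block witness (`k` kernel vectors).**  Let `M` be a real Hermitian (= symmetric) `n × n` matrix
and `U` an `n × k` real matrix whose columns lie in the kernel of `M`, `M * U = 0`.  Let `J : k → n` pick
`k` indices such that the `k × k` block `U.submatrix J id` (rows `J i`, all `k` columns) has non-zero
determinant.  If the principal submatrix of `M` on the complement of the range of `J` is positive
semidefinite, then `M` is positive semidefinite.  (`J` is automatically injective: a repeated row would make
the determinant vanish.)  Proof: for any `x` let `c := (U.submatrix J id)⁻¹ *ᵥ (x ∘ J)` and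
`w := x - U *ᵥ c`; then `w (J i) = 0` for every `i`, `M *ᵥ w = M *ᵥ x` because `M * U = 0`, and
`xᵀ M x = wᵀ M w` because `Uᵀ M = (M U)ᵀ = 0`; the right-hand side is the complement submatrix's quadratic
form at `w|`.  This is the soundness statement behind the certsdp-primal/1 witness mode
«chol-residual-face/1» with a kernel BASIS (`|J| = k ≥ 1`; the reader checks `M u_t = 0` for every column,
`det U_J ≠ 0`, and the ordinary Cholesky-residual inequality on `M_{-J}`).  The one-vector theorem
`posSemidef_of_mulVec_eq_zero_of_posSemidef_submatrix_erase` is the special case `k = Unit`, `U = col u`,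
`J = (fun _ => j)` (see `posSemidef_of_mulVec_eq_zero_of_posSemidef_submatrix_range_singleton` below).
[cite: HornJohnson2013, Observation 7.1.8 (a), p. 429] -/
theorem posSemidef_of_mul_eq_zero_of_posSemidef_submatrix_compl {k : Type*} [Fintype k] [DecidableEq k]
    {M : Matrix n n ℝ} (hM : M.IsHermitian) {U : Matrix n k ℝ} (hU : M * U = 0) {J : k → n}
    (hJ : (U.submatrix J id).det ≠ 0)
    (hsub : (M.submatrix (Subtype.val : {i // i ∉ Set.range J} → n)
        (Subtype.val : {i // i ∉ Set.range J} → n)).PosSemidef) :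
    M.PosSemidef := by
  classical
  have hT : Mᵀ = M := by
    have h := hM
    rw [Matrix.IsHermitian, Matrix.conjTranspose_eq_transpose_of_trivial] at h
    exact h
  refine Matrix.PosSemidef.of_dotProduct_mulVec_nonneg hM fun x => ?_
  -- the pivot block and the shifted vector
  set UJ : Matrix k k ℝ := U.submatrix J id with hUJ
  have hUJunit : IsUnit UJ.det := isUnit_iff_ne_zero.mpr hJ
  set c : k → ℝ := UJ⁻¹ *ᵥ (fun i => x (J i)) with hc
  set w : n → ℝ := x - U *ᵥ c with hw
  -- (1) `w` vanishes on the range of `J`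
  have hwJ : ∀ i : k, w (J i) = 0 := by
    intro i
    have hrow : (U *ᵥ c) (J i) = (UJ *ᵥ c) i := by
      simp only [hUJ, mulVec, dotProduct, submatrix_apply, id]
    have hcancel : UJ *ᵥ c = fun i => x (J i) := by
      rw [hc, Matrix.mulVec_mulVec, Matrix.mul_nonsing_inv _ hUJunit, Matrix.one_mulVec]
    simp only [hw, Pi.sub_apply]
    rw [hrow, hcancel, sub_self]
  have hw0 : ∀ i, ¬ (i ∉ Set.range J) → w i = 0 := by
    intro i hi
    obtain ⟨t, rfl⟩ := not_not.mp hi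
    exact hwJ t
  -- (2) `M w = M x`
  have hMw : M *ᵥ w = M *ᵥ x := by
    rw [hw, Matrix.mulVec_sub, Matrix.mulVec_mulVec, hU, Matrix.zero_mulVec, sub_zero]
  -- (3) symmetry: `(U c) ⬝ᵥ (M v) = (Mᵀ U c) ⬝ᵥ v = ((M U) c) ⬝ᵥ v = 0` for every `v`
  have huM : ∀ v : n → ℝ, (U *ᵥ c) ⬝ᵥ (M *ᵥ v) = 0 := by
    intro v
    rw [Matrix.dotProduct_mulVec, ← Matrix.mulVec_transpose, Matrix.mulVec_mulVec, hT, hU,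
      Matrix.zero_mulVec, zero_dotProduct]
  have hx : x = w + U *ᵥ c := by
    simp only [hw]; abel
  have hquad : x ⬝ᵥ (M *ᵥ x) = w ⬝ᵥ (M *ᵥ w) := by
    calc x ⬝ᵥ (M *ᵥ x) = x ⬝ᵥ (M *ᵥ w) := by rw [hMw]
      _ = (w + U *ᵥ c) ⬝ᵥ (M *ᵥ w) := by rw [← hx]
      _ = w ⬝ᵥ (M *ᵥ w) + (U *ᵥ c) ⬝ᵥ (M *ᵥ w) := by rw [add_dotProduct]
      _ = w ⬝ᵥ (M *ᵥ w) := by rw [huM, add_zero]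
  -- (4) the complement submatrix's quadratic form is non-negative
  have hstar : star x = x := by ext i; simp
  rw [hstar, hquad,
    dotProduct_mulVec_eq_submatrix_of_forall_not_apply_eq_zero M (fun i => i ∉ Set.range J) hw0]
  have h := hsub.dotProduct_mulVec_nonneg (fun i : {i // i ∉ Set.range J} => w i)
  have hstar' : star (fun i : {i // i ∉ Set.range J} => w (i : n)) =
      fun i : {i // i ∉ Set.range J} => w (i : n) := by
    ext i; simp
  rwa [hstar'] at h

/-- The one-vector case recovered from the `k`-vector statement (sanity link to
`posSemidef_of_mulVec_eq_zero_of_posSemidef_submatrix_erase`, whose complement `{i // i ≠ j}` is the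
range-complement of the constant map `Unit → n`, `() ↦ j`): with `k = Unit`, `U := (i, ()) ↦ u i` and
`J () := j`, the hypotheses read `M *ᵥ u = 0` and `u j ≠ 0`.
[cite: HornJohnson2013, Observation 7.1.8 (a), p. 429] -/
theorem posSemidef_of_mulVec_eq_zero_of_posSemidef_submatrix_range_singleton {M : Matrix n n ℝ}
    (hM : M.IsHermitian) {u : n → ℝ} (hu : M *ᵥ u = 0) {j : n} (hj : u j ≠ 0)
    (hsub : (M.submatrix (Subtype.val : {i // i ∉ Set.range (fun _ : Unit => j)} → n)
        (Subtype.val : {i // i ∉ Set.range (fun _ : Unit => j)} → n)).PosSemidef) :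
    M.PosSemidef := by
  classical
  refine posSemidef_of_mul_eq_zero_of_posSemidef_submatrix_compl (k := Unit) hM
    (U := Matrix.of fun i (_ : Unit) => u i) ?_ (J := fun _ : Unit => j) ?_ hsub
  · ext i t
    have := congrFun hu i
    simpa [Matrix.mul_apply, mulVec, dotProduct] using this
  · simpa [Matrix.det_unique, submatrix_apply] using hj

end Literature.Computation.Certificates
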